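import Summits.Ventures.LatticeQCDFlow.TrivializingMaps.AbelianTorusGirth

/-!
HONEST FRAMING: exact (Metropolis-corrected) sampling algorithms for lattice gauge theory; figures of
merit are autocorrelation/cost numbers at stated couplings and volumes; no continuum-physics claim.

# AbelianTail — volume-uniform TRUNCATION (locality / footprint) bound for the U(1) Lüscher series on `(ℤ/L)^d`
(THEORY-1.md §12.5 C2/C3, §12.12; the theory-pair ask "provable locality / volume-scaling")

Proposed tree path: `Summits/Ventures/LatticeQCDFlow/TrivializingMaps/AbelianTail.lean` (OURS). Imports
`AbelianTorusGirth.lean`. From the geometric bounds `Torus.locNorm_luscherCoeffs_le_sharp` (`L ≥ 4`, ratio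
`6(d-1)`) and `Torus.locNorm_luscherCoeffs_le` (every `L`, ratio `18(d-1)`): the `t`-series of per-link gradient
majorants is summable and its tail beyond order `K` is `≤ ((d-1)/2)(θ₀t)^(K+1)/(1-θ₀t)` with NO dependence on
`L`. Since the order-`K` truncation of the generator only involves links within plaquette-distance `K+1`, this
is the kernel-checked form of "footprint `O(log(1/ε))` per link, uniformly in the volume" in the convergent
regime `θ₀·tβ < 1` (the cost/acceptance reading itself is not formalised). 0 sorries, axioms
{propext, Classical.choice, Quot.sound}. Cell `lqcd-flow`, unit `pub-lqcd-theory1-g3`, 2026-08-21.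
-/

namespace Summit.Ventures.LatticeQCDFlow.TrivializingMaps.Abelian

open Finset

noncomputable section

namespace Torus

variable {d L : ℕ}

/-! ## Geometric tails: the volume-uniform TRUNCATION bound (locality / footprint corollary, THEORY-1 §12.5 C2–C3) -/

section Tail

/-- Elementary: a nonnegative sequence dominated by `C θ^k` has, for `0 ≤ t` with `θ t < 1`, a summable
`t`-power series whose tail beyond order `K` is at most `C (θt)^{K+1} / (1 - θt)`. -/
theorem tail_tsum_le_of_geometric {x : ℕ → ℝ} {C θ t : ℝ} (hx0 : ∀ k, 0 ≤ x k)
    (hx : ∀ k, x k ≤ C * θ ^ k) (hθ : 0 ≤ θ) (ht0 : 0 ≤ t) (h : θ * t < 1) (K : ℕ) :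
    Summable (fun k => t ^ k * x k) ∧
      ∑' k, t ^ (k + (K + 1)) * x (k + (K + 1)) ≤ C * (θ * t) ^ (K + 1) / (1 - θ * t) := by
  have hq0 : 0 ≤ θ * t := mul_nonneg hθ ht0
  have hC : 0 ≤ C := by
    have := (hx0 0).trans (hx 0)
    simpa using this
  have hterm : ∀ k, t ^ k * x k ≤ C * (θ * t) ^ k := fun k => by
    calc t ^ k * x k ≤ t ^ k * (C * θ ^ k) :=
          mul_le_mul_of_nonneg_left (hx k) (pow_nonneg ht0 k)
      _ = C * (θ * t) ^ k := by rw [mul_pow]; ring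
  have hnn : ∀ k, 0 ≤ t ^ k * x k := fun k => mul_nonneg (pow_nonneg ht0 k) (hx0 k)
  have hgeo : Summable fun k : ℕ => C * (θ * t) ^ k :=
    (summable_geometric_of_lt_one hq0 h).mul_left C
  have hsum : Summable fun k => t ^ k * x k :=
    Summable.of_nonneg_of_le hnn hterm hgeo
  refine ⟨hsum, ?_⟩
  have hshift : Summable fun k => t ^ (k + (K + 1)) * x (k + (K + 1)) :=
    (summable_nat_add_iff (K + 1)).2 hsum
  have hgeo' : Summable fun k : ℕ => C * (θ * t) ^ (k + (K + 1)) :=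
    (summable_nat_add_iff (f := fun k => C * (θ * t) ^ k) (K + 1)).2 hgeo
  calc ∑' k, t ^ (k + (K + 1)) * x (k + (K + 1))
      ≤ ∑' k, C * (θ * t) ^ (k + (K + 1)) :=
        Summable.tsum_le_tsum (fun k => hterm (k + (K + 1))) hshift hgeo'
    _ = C * (θ * t) ^ (K + 1) * ∑' k : ℕ, (θ * t) ^ k := by
        rw [← tsum_mul_left]; congr 1; funext k; ring
    _ = C * (θ * t) ^ (K + 1) / (1 - θ * t) := by
        rw [tsum_geometric_of_lt_one hq0 h, div_eq_mul_inv]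

variable (d L : ℕ) [NeZero L]

/-- **Volume-uniform truncation bound on the torus (OURS; THEORY-1 §12.5 C2/C3, U(1) line).** For `L ≥ 4`,
`0 ≤ t` and `6(d-1)·t < 1`, the per-link gradient majorants of the Lüscher coefficient functionals have a
summable `t`-series at every link `e` of `(ℤ/L)^d`, and the TAIL beyond order `K` obeys
`∑_{k > K} t^k N_e(a^{(k)}) ≤ ((d-1)/2) · (6(d-1)t)^{K+1} / (1 - 6(d-1)t)` — a bound in which `L` does not
occur. Reading (not formalised): the order-`K` truncation of the generator series involves only links within
plaquette-distance `K+1` of `e`, so at fixed `tβ < 1/(6(d-1))` precision `ε` per link costs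
`K = O(log(1/ε))` uniformly in the volume. -/
theorem locNorm_series_tail_le (hL : 4 ≤ L) {t : ℝ} (ht0 : 0 ≤ t)
    (ht : 3 * ((2 * (d - 1) : ℕ) : ℝ) * t < 1) (K : ℕ) (e : Link d L) :
    Summable (fun k => t ^ k * locNorm e (luscherCoeffs (complex d L) k)) ∧
      ∑' k, t ^ (k + (K + 1)) * locNorm e (luscherCoeffs (complex d L) (k + (K + 1))) ≤
        ((2 * (d - 1) : ℕ) : ℝ) / 4 * (3 * ((2 * (d - 1) : ℕ) : ℝ) * t) ^ (K + 1) /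
          (1 - 3 * ((2 * (d - 1) : ℕ) : ℝ) * t) :=
  tail_tsum_le_of_geometric (fun k => locNorm_nonneg e _)
    (fun k => locNorm_luscherCoeffs_le_sharp d L hL k e) (by positivity) ht0 ht K

/-- The same for EVERY `L ≥ 1` with the unconditional ratio `18(d-1)`: tail
`≤ ((d-1)/2) · (18(d-1)t)^{K+1} / (1 - 18(d-1)t)` for `0 ≤ t`, `18(d-1)t < 1`. -/
theorem locNorm_series_tail_le_all {t : ℝ} (ht0 : 0 ≤ t)
    (ht : 9 * ((2 * (d - 1) : ℕ) : ℝ) * t < 1) (K : ℕ) (e : Link d L) :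
    Summable (fun k => t ^ k * locNorm e (luscherCoeffs (complex d L) k)) ∧
      ∑' k, t ^ (k + (K + 1)) * locNorm e (luscherCoeffs (complex d L) (k + (K + 1))) ≤
        ((2 * (d - 1) : ℕ) : ℝ) / 4 * (9 * ((2 * (d - 1) : ℕ) : ℝ) * t) ^ (K + 1) /
          (1 - 9 * ((2 * (d - 1) : ℕ) : ℝ) * t) :=
  tail_tsum_le_of_geometric (fun k => locNorm_nonneg e _)
    (fun k => locNorm_luscherCoeffs_le d L k e) (by positivity) ht0 ht K

end Tail

end Torus

end

end Summit.Ventures.LatticeQCDFlow.TrivializingMaps.Abelian
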